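import Mathlib
import Summits.Ventures.PercRepro2.Defs
import Summits.Ventures.PercRepro2.Graph
import Summits.Ventures.PercRepro2.OneColourSwitch
import Summits.Ventures.PercRepro2.RegionHubSign
import Summits.Ventures.PercRepro2.SideSwitch
import Summits.Ventures.PercRepro2.SideSwitchFibre
import Summits.Ventures.PercRepro2.SideSwitchComps
import Summits.Ventures.PercRepro2.M9NoPocketDefs
import Summits.Ventures.PercRepro2.M9NoPocketWorld
import Summits.Ventures.PercRepro2.M9NoPocketWorldD
import Summits.Ventures.PercRepro2.M9NoPocketLegal
import Summits.Ventures.PercRepro2.M9NoPocketMono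
import Summits.Ventures.PercRepro2.M9NoPocketCompl
import Summits.Ventures.PercRepro2.M9NoPocketFreeBlock
import Summits.Ventures.PercRepro2.M9NoPocketFreeBlockK
import Summits.Ventures.PercRepro2.M9UnitAlgebra
import Summits.Ventures.PercRepro2.M9NoPocketSameType
import Summits.Ventures.PercRepro2.M9NoPocketLinkCompl
import Summits.Ventures.PercRepro2.M9NoPocketSigmaRS
import Summits.Ventures.PercRepro2.M9NoPocketUnitE
import Summits.Ventures.PercRepro2.M9NoPocketRK

/-!
# The monotonicity data of a unit (blind cell PercRepro2, p3 g36, 2026-08-29;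
`proofs/P3-NPHDR.md` §5(c), (f) — the hypotheses of the quad inequalities, packaged)

For a same-type representative `ρ₀` and its outside flip: `[p ~_Y q]` is monotone in the
switched block set for both (`y_mono`), so the `HW` count is monotone in the joined `W`-side set
(`HW_mono`) and `HY ≤ HW` (`HY_le_HW`, through `T ↦ T ∪ 𝔉L`); the link indicator `ℓ` is
monotone (`link_mono`), `0 ≤ ℓ ≤ 1` and `ℓ ∅ = 0` (`link_empty`, `not_conn_rs_all_switched`).
These are the facts used inline by `unit_reached_nonpos`; stated once here for the sharpened
crux.  Own work; std axioms.
-/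

namespace Summit.Ventures.PercRepro2

namespace NoPocket

open Finset Classical RegionHub OneColourSwitch SideSwitch M9Reduce

variable {V : Type*} {E : Type*}

section UnitMono

variable [Fintype V] [DecidableEq V] [Fintype E] [DecidableEq E] {ends : E → Sym2 V}

/-- `[p ~_Y q]` is monotone in the switched block set, for `ρ₀` and for its outside flip. -/
lemma y_mono {p q r s d : V} (hnp : NoPocketAt ends d r s) (hpd : p ≠ d) (hqd : q ≠ d)
    (hr : d ≠ r) (hs : d ≠ s) (hT : Tset ends d r s = ∅) (hloop : ∀ e, ends e ≠ s(d, d))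
    {ρ₀ : Config E} (hρ₀ : ρ₀ ∈ RepD ends p q r s d) (hst : ∀ e, d ∈ ends e → ρ₀ e = true)
    {X X' : Finset (Finset V)} (hXX' : X ⊆ X') (hX' : X' ⊆ blocks ends d r s ρ₀) :
    (if Conn ends (assignX ends (X, ∅) ρ₀) p q then (1 : ℤ) else 0) +
        (if Conn ends (assignX ends (X, ∅) (flipOp ends d r s ρ₀)) p q then 1 else 0) ≤
      (if Conn ends (assignX ends (X', ∅) ρ₀) p q then (1 : ℤ) else 0) +
        (if Conn ends (assignX ends (X', ∅) (flipOp ends d r s ρ₀)) p q then 1 else 0) := by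
  have hρ₁ := flipOp_mem_RepD hr hs hρ₀
  have hst₁ := sameType_flipOp hnp hr hs hT hloop hρ₀ hst
  have hX'' : X' ⊆ blocks ends d r s (flipOp ends d r s ρ₀) := by
    rw [blocks_flipOp hr hs]; exact hX'
  refine add_le_add ?_ ?_
  · exact ite_le_ite_of_imp (conn_pq_assignX_mono hnp hpd hqd hr hs hρ₀
      (Prod.le_def.2 ⟨hXX', le_rfl⟩) ((mem_L4_sameType_iff hT hst).2 ⟨hXX'.trans hX', rfl⟩)
      ((mem_L4_sameType_iff hT hst).2 ⟨hX', rfl⟩))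
  · exact ite_le_ite_of_imp (conn_pq_assignX_mono hnp hpd hqd hr hs hρ₁
      (Prod.le_def.2 ⟨hXX', le_rfl⟩) ((mem_L4_sameType_iff hT hst₁).2 ⟨hXX'.trans hX'', rfl⟩)
      ((mem_L4_sameType_iff hT hst₁).2 ⟨hX'', rfl⟩))

/-- `HW` is monotone in the joined `W`-side set. -/
lemma HW_mono {p q r s d : V} (hnp : NoPocketAt ends d r s) (hpd : p ≠ d) (hqd : q ≠ d)
    (hr : d ≠ r) (hs : d ≠ s) (hT : Tset ends d r s = ∅) (hloop : ∀ e, ends e ≠ s(d, d))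
    {ρ₀ : Config E} (hρ₀ : ρ₀ ∈ RepD ends p q r s d) (hst : ∀ e, d ∈ ends e → ρ₀ e = true)
    {𝔉 𝔑 : Finset (Finset V)}
    (h𝔉 : 𝔉 = (blocks ends d r s ρ₀).filter (fun C => ¬ hasY ends d ρ₀ C))
    (h𝔑 : 𝔑 = (blocks ends d r s ρ₀).filter (hasY ends d ρ₀)) :
    ∀ S ⊆ 𝔑, ∀ S' ⊆ 𝔑, S ⊆ S' →
      (∑ T ∈ 𝔉.powerset.filter (fun T => 𝔉.filter (LinksIn ends ρ₀ r s) ⊆ T),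
          ((if Conn ends (assignX ends (T ∪ S, ∅) ρ₀) p q then (1 : ℤ) else 0) +
            (if Conn ends (assignX ends (T ∪ S, ∅) (flipOp ends d r s ρ₀)) p q
              then 1 else 0))) ≤
        (∑ T ∈ 𝔉.powerset.filter (fun T => 𝔉.filter (LinksIn ends ρ₀ r s) ⊆ T),
          ((if Conn ends (assignX ends (T ∪ S', ∅) ρ₀) p q then (1 : ℤ) else 0) +
            (if Conn ends (assignX ends (T ∪ S', ∅) (flipOp ends d r s ρ₀)) p q
              then 1 else 0))) := by
  intro S _ S' hS' hSS'
  refine Finset.sum_le_sum (fun T hTp => ?_)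
  have hTf : T ⊆ 𝔉 := Finset.mem_powerset.1 (Finset.mem_filter.1 hTp).1
  have h𝔉b : 𝔉 ⊆ blocks ends d r s ρ₀ := by rw [h𝔉]; exact Finset.filter_subset _ _
  have h𝔑b : 𝔑 ⊆ blocks ends d r s ρ₀ := by rw [h𝔑]; exact Finset.filter_subset _ _
  exact y_mono hnp hpd hqd hr hs hT hloop hρ₀ hst (Finset.union_subset_union_right hSS')
    (Finset.union_subset (hTf.trans h𝔉b) (hS'.trans h𝔑b))

/-- `HY ≤ HW` on the joined subsets. -/
lemma HY_le_HW {p q r s d : V} (hnp : NoPocketAt ends d r s) (hpd : p ≠ d) (hqd : q ≠ d)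
    (hr : d ≠ r) (hs : d ≠ s) (hT : Tset ends d r s = ∅) (hloop : ∀ e, ends e ≠ s(d, d))
    {ρ₀ : Config E} (hρ₀ : ρ₀ ∈ RepD ends p q r s d) (hst : ∀ e, d ∈ ends e → ρ₀ e = true)
    {𝔉 𝔑 : Finset (Finset V)}
    (h𝔉 : 𝔉 = (blocks ends d r s ρ₀).filter (fun C => ¬ hasY ends d ρ₀ C))
    (h𝔑 : 𝔑 = (blocks ends d r s ρ₀).filter (hasY ends d ρ₀)) :
    ∀ S ⊆ 𝔑,
      (∑ T ∈ 𝔉.powerset.filter (fun T => T ∩ 𝔉.filter (LinksIn ends ρ₀ r s) = ∅),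
          ((if Conn ends (assignX ends (T ∪ S, ∅) ρ₀) p q then (1 : ℤ) else 0) +
            (if Conn ends (assignX ends (T ∪ S, ∅) (flipOp ends d r s ρ₀)) p q
              then 1 else 0))) ≤
        (∑ T ∈ 𝔉.powerset.filter (fun T => 𝔉.filter (LinksIn ends ρ₀ r s) ⊆ T),
          ((if Conn ends (assignX ends (T ∪ S, ∅) ρ₀) p q then (1 : ℤ) else 0) +
            (if Conn ends (assignX ends (T ∪ S, ∅) (flipOp ends d r s ρ₀)) p q
              then 1 else 0))) := by
  intro S hS
  have hLf : 𝔉.filter (LinksIn ends ρ₀ r s) ⊆ 𝔉 := Finset.filter_subset _ _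
  have h𝔉b : 𝔉 ⊆ blocks ends d r s ρ₀ := by rw [h𝔉]; exact Finset.filter_subset _ _
  have h𝔑b : 𝔑 ⊆ blocks ends d r s ρ₀ := by rw [h𝔑]; exact Finset.filter_subset _ _
  rw [← sum_filter_inter_empty_eq_sum_union hLf (fun T =>
    (if Conn ends (assignX ends (T ∪ S, ∅) ρ₀) p q then (1 : ℤ) else 0) +
      (if Conn ends (assignX ends (T ∪ S, ∅) (flipOp ends d r s ρ₀)) p q then 1 else 0))]
  refine Finset.sum_le_sum (fun T hTp => ?_)
  have hTf : T ⊆ 𝔉 := Finset.mem_powerset.1 (Finset.mem_filter.1 hTp).1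
  exact y_mono hnp hpd hqd hr hs hT hloop hρ₀ hst
    (Finset.union_subset_union_left Finset.subset_union_left)
    (Finset.union_subset (Finset.union_subset (hTf.trans h𝔉b) (hLf.trans h𝔉b)) (hS.trans h𝔑b))

/-- The link indicator is monotone in the joined `Y`-side set. -/
lemma link_mono {p q r s d : V} (hnp : NoPocketAt ends d r s) (hpd : p ≠ d) (hqd : q ≠ d)
    (hr : d ≠ r) (hs : d ≠ s) (hT : Tset ends d r s = ∅) {ρ₀ : Config E}
    (hρ₀ : ρ₀ ∈ RepD ends p q r s d) (hst : ∀ e, d ∈ ends e → ρ₀ e = true)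
    {𝔉 𝔑 : Finset (Finset V)}
    (h𝔉 : 𝔉 = (blocks ends d r s ρ₀).filter (fun C => ¬ hasY ends d ρ₀ C))
    (h𝔑 : 𝔑 = (blocks ends d r s ρ₀).filter (hasY ends d ρ₀)) :
    ∀ S ⊆ 𝔑, ∀ S' ⊆ 𝔑, S ⊆ S' →
      (if Conn ends (assignX ends (𝔉 ∪ (𝔑 \ S), ∅) ρ₀) r s then (1 : ℤ) else 0) ≤
        (if Conn ends (assignX ends (𝔉 ∪ (𝔑 \ S'), ∅) ρ₀) r s then 1 else 0) := by
  intro S _ S' _ hSS'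
  have h𝔉b : 𝔉 ⊆ blocks ends d r s ρ₀ := by rw [h𝔉]; exact Finset.filter_subset _ _
  have h𝔑b : 𝔑 ⊆ blocks ends d r s ρ₀ := by rw [h𝔑]; exact Finset.filter_subset _ _
  have hx : (𝔉 ∪ (𝔑 \ S'), (∅ : Finset E)) ∈ L4 ends d r s ρ₀ :=
    (mem_L4_sameType_iff hT hst).2 ⟨Finset.union_subset h𝔉b (Finset.sdiff_subset.trans h𝔑b), rfl⟩
  have hx' : (𝔉 ∪ (𝔑 \ S), (∅ : Finset E)) ∈ L4 ends d r s ρ₀ :=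
    (mem_L4_sameType_iff hT hst).2 ⟨Finset.union_subset h𝔉b (Finset.sdiff_subset.trans h𝔑b), rfl⟩
  exact ite_le_ite_of_imp (conn_rs_assignX_anti hnp hpd hqd hr hs hρ₀
    (Prod.le_def.2 ⟨Finset.union_subset_union_right
      (Finset.sdiff_subset_sdiff (Finset.Subset.refl _) hSS'), le_rfl⟩) hx hx')

/-- The link indicator vanishes at the empty joined `Y`-side set. -/
lemma link_empty {p q r s d : V} (hnp : NoPocketAt ends d r s) (hr : d ≠ r) (hs : d ≠ s)
    (hT : Tset ends d r s = ∅) (hrs : ∀ e, ends e ≠ s(r, s)) (hrs' : r ≠ s) {ρ₀ : Config E}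
    (hρ₀ : ρ₀ ∈ RepD ends p q r s d) (hst : ∀ e, d ∈ ends e → ρ₀ e = true)
    {𝔉 𝔑 : Finset (Finset V)}
    (h𝔉 : 𝔉 = (blocks ends d r s ρ₀).filter (fun C => ¬ hasY ends d ρ₀ C))
    (h𝔑 : 𝔑 = (blocks ends d r s ρ₀).filter (hasY ends d ρ₀)) :
    (if Conn ends (assignX ends (𝔉 ∪ (𝔑 \ ∅), ∅) ρ₀) r s then (1 : ℤ) else 0) = 0 := by
  rw [Finset.sdiff_empty, h𝔉, h𝔑, free_union_joined,
    if_neg (not_conn_rs_all_switched hnp hr hs hT hrs hrs' hρ₀ hst)]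

end UnitMono

end NoPocket

end Summit.Ventures.PercRepro2
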